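import Mathlib.Analysis.Calculus.ContDiff.Bounds
import Mathlib.Analysis.Calculus.ContDiff.Basic
import Mathlib.Analysis.Calculus.IteratedDeriv.Lemmas
import HarnessLib

/-!
# Maps of open cubes with bounded Fréchet derivatives (tools for Pila–Wilkie 2006, §5 and Cor. 5.1)

Topic `Literature/ModelTheory/ExponentialFields`; pure-analysis proof file in the cone of the
named fact `PilaWilkie2006_thm_1_8`.  The higher-dimensional `r`-parametrization (Pila–Wilkie
2006, §5) builds charts `(0,1)^ℓ → ℝ^n` from lower-dimensional ones by cylinders, graphs, bands
(*"`θ(x) = (φ∘ψ(x'), (1 − x_{l+1})·f∘φ∘ψ(x') + x_{l+1}·g∘φ∘ψ(x'))`"*), compositions `φ ∘ ψ`,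
and finally renormalizes all derivative bounds to `1` by subdivision (Cor. 5.1: *"Cover
`(0,1)^{dim X}` with `(2c)^{dim X}` cubes of side `1/c` and for each such cube `K` let
`λ_K : (0,1)^{dim X} → K` be the obvious linear bijection"*).  This file supplies the
corresponding estimates in the form consumed by `PilaWilkie2006_prop_6_1`
(`ContDiffOn` on the open cube and bounds on `‖iteratedFDeriv ℝ q · x‖`):

* `contDiffOn_norm_iteratedFDeriv_comp_init`, `…_comp_coord`, `…_coord`, `…_one_sub_coord` —
  cylinder and coordinate maps keep the bounds (projections have operator norm `≤ 1`);
* `norm_iteratedFDeriv_mul_le_two_pow`, `contDiffOn_norm_iteratedFDeriv_band` — Leibniz: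
  band maps have bounds `2^{q+1} C`;
* `norm_iteratedFDerivWithin_pi_le`, `contDiffOn_norm_iteratedFDeriv_comp_cube` — composition
  (`‖D^q(φ∘ψ)‖ ≤ q!·C·D^q`, Mathlib's Faà di Bruno estimate);
* `norm_iteratedFDeriv_comp_affine_le`, `subdivision_grid` — affine reparametrization scales
  `D^q` by `|κ|^q`; the half-overlapping grid of `(2K−1)^ℓ` subcubes of side `1/K` covers the
  open cube.

Nothing here is a named fact; no definitions; Mathlib only.

## References

* J. Pila, A. J. Wilkie, *The rational points of a definable set*, Duke Math. J. 133 (2006),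
  §5 and Cor. 5.1. [PilaWilkie2006]
-/

noncomputable section

open Set

namespace Literature.ModelTheory.ExponentialFields

/-! ### Fréchet bounds for cylinder and band maps on open cubes (Pila–Wilkie 2006, §5, proof of `(II)_m`) -/

section BandMaps

/-- The open cube `(0,1)^{ℓ+1}` projects into `(0,1)^ℓ` under `Fin.init`. [folklore] -/
theorem mapsTo_init_cube (ℓ : ℕ) :
    MapsTo (Fin.init : (Fin (ℓ + 1) → ℝ) → Fin ℓ → ℝ) (Set.pi Set.univ fun _ : Fin (ℓ + 1) => Ioo (0 : ℝ) 1)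
      (Set.pi Set.univ fun _ : Fin ℓ => Ioo (0 : ℝ) 1) :=
  fun _ hz i _ => hz (Fin.castSucc i) (mem_univ _)

/-- **Cylinder maps**: if `h` is `C^r` on the open cube `(0,1)^ℓ` with `‖D^q h‖ ≤ C` (`q ≤ r`),
then `z ↦ h(init z)` is `C^r` on `(0,1)^{ℓ+1}` with the same bounds (composition with the
coordinate projection, of operator norm `≤ 1`). [folklore] -/
theorem contDiffOn_norm_iteratedFDeriv_comp_init {ℓ r : ℕ} {h : (Fin ℓ → ℝ) → ℝ} {C : ℝ}
    (hh : ContDiffOn ℝ r h (Set.pi Set.univ fun _ : Fin ℓ => Ioo (0 : ℝ) 1))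
    (hb : ∀ q ≤ r, ∀ y ∈ Set.pi Set.univ (fun _ : Fin ℓ => Ioo (0 : ℝ) 1), ‖iteratedFDeriv ℝ q h y‖ ≤ C) :
    ContDiffOn ℝ r (fun z : Fin (ℓ + 1) → ℝ => h (Fin.init z)) (Set.pi Set.univ fun _ : Fin (ℓ + 1) => Ioo (0 : ℝ) 1) ∧
      ∀ q ≤ r, ∀ z ∈ Set.pi Set.univ (fun _ : Fin (ℓ + 1) => Ioo (0 : ℝ) 1),
        ‖iteratedFDeriv ℝ q (fun z : Fin (ℓ + 1) → ℝ => h (Fin.init z)) z‖ ≤ C := by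
  -- `init` as a continuous linear map of norm `≤ 1`
  set P : (Fin (ℓ + 1) → ℝ) →L[ℝ] (Fin ℓ → ℝ) :=
    ContinuousLinearMap.pi fun i : Fin ℓ => ContinuousLinearMap.proj (R := ℝ) (Fin.castSucc i) with hP
  have hPapply : ∀ z, P z = Fin.init z := fun z => by ext i; rfl
  have hcomp : (fun z : Fin (ℓ + 1) → ℝ => h (Fin.init z)) = h ∘ P := by
    funext z; simp only [Function.comp_apply, hPapply]
  set cube : Set (Fin ℓ → ℝ) := Set.pi Set.univ fun _ : Fin ℓ => Ioo (0 : ℝ) 1 with hcube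
  set cube' : Set (Fin (ℓ + 1) → ℝ) := Set.pi Set.univ fun _ : Fin (ℓ + 1) => Ioo (0 : ℝ) 1 with hcube'
  have hopen : IsOpen cube := isOpen_set_pi finite_univ fun _ _ => isOpen_Ioo
  have hopen' : IsOpen cube' := isOpen_set_pi finite_univ fun _ _ => isOpen_Ioo
  have hsub : cube' ⊆ P ⁻¹' cube := fun z hz => by
    show P z ∈ cube
    rw [hPapply]; exact mapsTo_init_cube ℓ hz
  have hPn : ‖P‖ ≤ 1 := by
    refine ContinuousLinearMap.opNorm_le_bound _ zero_le_one fun z => ?_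
    rw [one_mul, hPapply, pi_norm_le_iff_of_nonneg (norm_nonneg _)]
    intro i
    exact norm_le_pi_norm z (Fin.castSucc i)
  have hCr : ContDiffOn ℝ r (fun z : Fin (ℓ + 1) → ℝ => h (Fin.init z)) cube' := by
    rw [hcomp]
    exact hh.comp P.contDiff.contDiffOn (fun z hz => hsub hz)
  refine ⟨hCr, fun q hq z hz => ?_⟩
  -- compute within the open preimage `P ⁻¹' cube ⊇ cube'`
  have hpre : IsOpen (P ⁻¹' cube) := hopen.preimage P.continuous
  have hzpre : z ∈ P ⁻¹' cube := hsub hz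
  rw [← iteratedFDerivWithin_of_isOpen q hpre hzpre, hcomp]
  have hcr := P.iteratedFDerivWithin_comp_right hh hopen.uniqueDiffOn hpre.uniqueDiffOn hzpre
    (i := q) (by exact_mod_cast hq)
  rw [hcr]
  calc ‖(iteratedFDerivWithin ℝ q h cube (P z)).compContinuousLinearMap fun _ => P‖
      ≤ ‖iteratedFDerivWithin ℝ q h cube (P z)‖ * ∏ _i : Fin q, ‖P‖ :=
        ContinuousMultilinearMap.norm_compContinuousLinearMap_le _ _
    _ ≤ C * 1 := by
        have hC : 0 ≤ C := (norm_nonneg _).trans (hb 0 (Nat.zero_le _) (P z) hzpre)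
        apply mul_le_mul _ (Finset.prod_le_one (fun _ _ => norm_nonneg _) fun _ _ => hPn)
          (Finset.prod_nonneg fun _ _ => norm_nonneg _) hC
        rw [iteratedFDerivWithin_of_isOpen q hopen hzpre]
        exact hb q hq (P z) hzpre
    _ = C := mul_one C


/-- **Coordinate maps**: if `f : ℝ → ℝ` is `C^r` on `(0,1)` with `|f^{(q)}| ≤ C` (`q ≤ r`,
derivatives within `(0,1)`), then for any coordinate `j` the map `z ↦ f(z_j)` is `C^r` on the
open cube `(0,1)^n` with `‖D^q‖ ≤ C`. [folklore] -/
theorem contDiffOn_norm_iteratedFDeriv_comp_coord {n r : ℕ} (j : Fin n) {f : ℝ → ℝ} {C : ℝ}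
    (hf : ContDiffOn ℝ r f (Ioo 0 1))
    (hb : ∀ q ≤ r, ∀ y ∈ Ioo (0 : ℝ) 1, |iteratedDerivWithin q f (Ioo 0 1) y| ≤ C) :
    ContDiffOn ℝ r (fun z : Fin n → ℝ => f (z j)) (Set.pi Set.univ fun _ : Fin n => Ioo (0 : ℝ) 1) ∧
      ∀ q ≤ r, ∀ z ∈ Set.pi Set.univ (fun _ : Fin n => Ioo (0 : ℝ) 1),
        ‖iteratedFDeriv ℝ q (fun z : Fin n → ℝ => f (z j)) z‖ ≤ C := by
  set P : (Fin n → ℝ) →L[ℝ] ℝ := ContinuousLinearMap.proj (R := ℝ) j with hP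
  have hcomp : (fun z : Fin n → ℝ => f (z j)) = f ∘ P := rfl
  set cube : Set (Fin n → ℝ) := Set.pi Set.univ fun _ : Fin n => Ioo (0 : ℝ) 1 with hcube
  have hopen : IsOpen (Ioo (0 : ℝ) 1) := isOpen_Ioo
  have hsub : cube ⊆ P ⁻¹' Ioo 0 1 := fun z hz => hz j (mem_univ _)
  have hPn : ‖P‖ ≤ 1 := by
    refine ContinuousLinearMap.opNorm_le_bound _ zero_le_one fun z => ?_
    rw [one_mul]; exact norm_le_pi_norm z j
  have hCr : ContDiffOn ℝ r (fun z : Fin n → ℝ => f (z j)) cube := by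
    rw [hcomp]; exact hf.comp P.contDiff.contDiffOn fun z hz => hsub hz
  refine ⟨hCr, fun q hq z hz => ?_⟩
  have hpre : IsOpen (P ⁻¹' Ioo 0 1) := hopen.preimage P.continuous
  have hzpre : z ∈ P ⁻¹' Ioo 0 1 := hsub hz
  rw [← iteratedFDerivWithin_of_isOpen q hpre hzpre, hcomp]
  have hcr := P.iteratedFDerivWithin_comp_right hf (uniqueDiffOn_Ioo 0 1) hpre.uniqueDiffOn hzpre
    (i := q) (by exact_mod_cast hq)
  rw [hcr]
  have hC : 0 ≤ C := (abs_nonneg _).trans (hb 0 (Nat.zero_le _) (P z) hzpre)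
  calc ‖(iteratedFDerivWithin ℝ q f (Ioo 0 1) (P z)).compContinuousLinearMap fun _ => P‖
      ≤ ‖iteratedFDerivWithin ℝ q f (Ioo 0 1) (P z)‖ * ∏ _i : Fin q, ‖P‖ :=
        ContinuousMultilinearMap.norm_compContinuousLinearMap_le _ _
    _ ≤ C * 1 := by
        apply mul_le_mul _ (Finset.prod_le_one (fun _ _ => norm_nonneg _) fun _ _ => hPn)
          (Finset.prod_nonneg fun _ _ => norm_nonneg _) hC
        rw [norm_iteratedFDerivWithin_eq_norm_iteratedDerivWithin, Real.norm_eq_abs]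
        exact hb q hq (P z) hzpre
    _ = C := mul_one C

/-- The coordinate function `z ↦ z_j` on the open cube: `C^∞` with `‖D^q‖ ≤ 1` for all `q`.
[folklore] -/
theorem contDiffOn_norm_iteratedFDeriv_coord {n : ℕ} (j : Fin n) (r : ℕ) :
    ContDiffOn ℝ r (fun z : Fin n → ℝ => z j) (Set.pi Set.univ fun _ : Fin n => Ioo (0 : ℝ) 1) ∧
      ∀ q ≤ r, ∀ z ∈ Set.pi Set.univ (fun _ : Fin n => Ioo (0 : ℝ) 1),
        ‖iteratedFDeriv ℝ q (fun z : Fin n → ℝ => z j) z‖ ≤ 1 := by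
  have h := contDiffOn_norm_iteratedFDeriv_comp_coord (r := r) j (f := fun y : ℝ => y) (C := 1)
    contDiffOn_id ?_
  · exact h
  · intro q _ y hy
    rcases q with _ | _ | q
    · simp only [iteratedDerivWithin_zero]; rw [abs_of_pos hy.1]; exact hy.2.le
    · rw [iteratedDerivWithin_one, derivWithin_of_isOpen isOpen_Ioo hy, deriv_id'']; simp
    · have hid : ∀ w ∈ Ioo (0 : ℝ) 1, derivWithin (fun y : ℝ => y) (Ioo 0 1) w = 1 := fun w hw => by
        rw [derivWithin_of_isOpen isOpen_Ioo hw, deriv_id'']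
      rw [iteratedDerivWithin_succ', iteratedDerivWithin_congr (f := derivWithin (fun y : ℝ => y) (Ioo 0 1))
        (g := fun _ => (1 : ℝ)) hid hy, iteratedDerivWithin_const]
      simp


/-- The function `z ↦ 1 − z_j` on the open cube: `C^∞` with `‖D^q‖ ≤ 1` for all `q`.
[folklore] -/
theorem contDiffOn_norm_iteratedFDeriv_one_sub_coord {n : ℕ} (j : Fin n) (r : ℕ) :
    ContDiffOn ℝ r (fun z : Fin n → ℝ => 1 - z j) (Set.pi Set.univ fun _ : Fin n => Ioo (0 : ℝ) 1) ∧
      ∀ q ≤ r, ∀ z ∈ Set.pi Set.univ (fun _ : Fin n => Ioo (0 : ℝ) 1),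
        ‖iteratedFDeriv ℝ q (fun z : Fin n → ℝ => 1 - z j) z‖ ≤ 1 := by
  have h := contDiffOn_norm_iteratedFDeriv_comp_coord (r := r) j (f := fun y : ℝ => 1 - y) (C := 1)
    (contDiffOn_const.sub contDiffOn_id) ?_
  · exact h
  · intro q _ y hy
    have hd : ∀ w ∈ Ioo (0 : ℝ) 1, derivWithin (fun y : ℝ => 1 - y) (Ioo 0 1) w = -1 := fun w hw => by
      rw [derivWithin_of_isOpen isOpen_Ioo hw, deriv_const_sub, deriv_id'']
    rcases q with _ | _ | q
    · simp only [iteratedDerivWithin_zero]; rw [abs_of_pos (by linarith [hy.2])]; linarith [hy.1]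
    · rw [iteratedDerivWithin_one, hd y hy]; simp
    · rw [iteratedDerivWithin_succ', iteratedDerivWithin_congr (f := derivWithin (fun y : ℝ => 1 - y) (Ioo 0 1))
        (g := fun _ => (-1 : ℝ)) hd hy, iteratedDerivWithin_const]
      simp

/-- **Products with a factor of derivative bounds `1`**: on the open cube, if `u` is `C^r` with
`‖D^i u‖ ≤ 1` and `F` is `C^r` with `‖D^i F‖ ≤ C` (`i ≤ r`), then `‖D^q (u F)‖ ≤ 2^q C`
(Leibniz, `∑ (q choose i) = 2^q`). [folklore] -/
theorem norm_iteratedFDeriv_mul_le_two_pow {n r : ℕ} {u F : (Fin n → ℝ) → ℝ} {C : ℝ}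
    (hu : ContDiffOn ℝ r u (Set.pi Set.univ fun _ : Fin n => Ioo (0 : ℝ) 1))
    (hF : ContDiffOn ℝ r F (Set.pi Set.univ fun _ : Fin n => Ioo (0 : ℝ) 1))
    (hbu : ∀ q ≤ r, ∀ z ∈ Set.pi Set.univ (fun _ : Fin n => Ioo (0 : ℝ) 1), ‖iteratedFDeriv ℝ q u z‖ ≤ 1)
    (hbF : ∀ q ≤ r, ∀ z ∈ Set.pi Set.univ (fun _ : Fin n => Ioo (0 : ℝ) 1), ‖iteratedFDeriv ℝ q F z‖ ≤ C) :
    ContDiffOn ℝ r (fun z => u z * F z) (Set.pi Set.univ fun _ : Fin n => Ioo (0 : ℝ) 1) ∧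
      ∀ q ≤ r, ∀ z ∈ Set.pi Set.univ (fun _ : Fin n => Ioo (0 : ℝ) 1),
        ‖iteratedFDeriv ℝ q (fun z => u z * F z) z‖ ≤ 2 ^ q * C := by
  set s : Set (Fin n → ℝ) := Set.pi Set.univ fun _ : Fin n => Ioo (0 : ℝ) 1 with hs
  have hopen : IsOpen s := isOpen_set_pi finite_univ fun _ _ => isOpen_Ioo
  have hsu : UniqueDiffOn ℝ s := hopen.uniqueDiffOn
  refine ⟨hu.mul hF, fun q hq z hz => ?_⟩
  have hC : 0 ≤ C := (norm_nonneg _).trans (hbF 0 (Nat.zero_le _) z hz)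
  rw [← iteratedFDerivWithin_of_isOpen q hopen hz]
  have h := norm_iteratedFDerivWithin_mul_le (N := (r : WithTop ℕ∞)) hu hF hsu hz (n := q)
    (by exact_mod_cast hq)
  refine h.trans ?_
  calc ∑ i ∈ Finset.range (q + 1), (q.choose i : ℝ) * ‖iteratedFDerivWithin ℝ i u s z‖ *
          ‖iteratedFDerivWithin ℝ (q - i) F s z‖
      ≤ ∑ i ∈ Finset.range (q + 1), (q.choose i : ℝ) * 1 * C := by
        apply Finset.sum_le_sum
        intro i hi
        have hi' : i ≤ q := Nat.lt_succ_iff.mp (Finset.mem_range.mp hi)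
        have h1 : ‖iteratedFDerivWithin ℝ i u s z‖ ≤ 1 := by
          rw [iteratedFDerivWithin_of_isOpen i hopen hz]; exact hbu i (hi'.trans hq) z hz
        have h2 : ‖iteratedFDerivWithin ℝ (q - i) F s z‖ ≤ C := by
          rw [iteratedFDerivWithin_of_isOpen (q - i) hopen hz]; exact hbF (q - i) (by omega) z hz
        apply mul_le_mul (mul_le_mul_of_nonneg_left h1 (by positivity)) h2 (norm_nonneg _) (by positivity)
    _ = 2 ^ q * C := by
        rw [← Finset.sum_mul, ← Finset.sum_mul]
        congr 1
        rw [mul_one]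
        have := Nat.sum_range_choose q
        exact_mod_cast this

/-- **Band maps** (Pila–Wilkie 2006, §5, proof of `(II)_m`: *"`θ(x) = (φ∘ψ(x'),
(1 − x_{l+1})·f∘φ∘ψ(x') + x_{l+1}·g∘φ∘ψ(x'))`"*): if `F, G` are `C^r` on the open cube
`(0,1)^n` with `‖D^q F‖, ‖D^q G‖ ≤ C` (`q ≤ r`), then for a coordinate `j` the function
`z ↦ (1 − z_j) F(z) + z_j G(z)` is `C^r` on the cube with `‖D^q‖ ≤ 2^{q+1} C`.
[cite: PilaWilkie2006, §5] -/
theorem contDiffOn_norm_iteratedFDeriv_band {n r : ℕ} (j : Fin n) {F G : (Fin n → ℝ) → ℝ} {C : ℝ}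
    (hF : ContDiffOn ℝ r F (Set.pi Set.univ fun _ : Fin n => Ioo (0 : ℝ) 1))
    (hG : ContDiffOn ℝ r G (Set.pi Set.univ fun _ : Fin n => Ioo (0 : ℝ) 1))
    (hbF : ∀ q ≤ r, ∀ z ∈ Set.pi Set.univ (fun _ : Fin n => Ioo (0 : ℝ) 1), ‖iteratedFDeriv ℝ q F z‖ ≤ C)
    (hbG : ∀ q ≤ r, ∀ z ∈ Set.pi Set.univ (fun _ : Fin n => Ioo (0 : ℝ) 1), ‖iteratedFDeriv ℝ q G z‖ ≤ C) :
    ContDiffOn ℝ r (fun z : Fin n → ℝ => (1 - z j) * F z + z j * G z)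
        (Set.pi Set.univ fun _ : Fin n => Ioo (0 : ℝ) 1) ∧
      ∀ q ≤ r, ∀ z ∈ Set.pi Set.univ (fun _ : Fin n => Ioo (0 : ℝ) 1),
        ‖iteratedFDeriv ℝ q (fun z : Fin n → ℝ => (1 - z j) * F z + z j * G z) z‖ ≤ 2 ^ (q + 1) * C := by
  set s : Set (Fin n → ℝ) := Set.pi Set.univ fun _ : Fin n => Ioo (0 : ℝ) 1 with hs
  have hopen : IsOpen s := isOpen_set_pi finite_univ fun _ _ => isOpen_Ioo
  have hsu : UniqueDiffOn ℝ s := hopen.uniqueDiffOn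
  obtain ⟨hu1, hbu1⟩ := contDiffOn_norm_iteratedFDeriv_one_sub_coord j r (n := n)
  obtain ⟨hu2, hbu2⟩ := contDiffOn_norm_iteratedFDeriv_coord j r (n := n)
  obtain ⟨hA, hbA⟩ := norm_iteratedFDeriv_mul_le_two_pow hu1 hF hbu1 hbF
  obtain ⟨hB, hbB⟩ := norm_iteratedFDeriv_mul_le_two_pow hu2 hG hbu2 hbG
  refine ⟨hA.add hB, fun q hq z hz => ?_⟩
  rw [← iteratedFDerivWithin_of_isOpen q hopen hz]
  have hadd : iteratedFDerivWithin ℝ q (fun z : Fin n → ℝ => (1 - z j) * F z + z j * G z) s z =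
      iteratedFDerivWithin ℝ q (fun z : Fin n → ℝ => (1 - z j) * F z) s z +
        iteratedFDerivWithin ℝ q (fun z : Fin n → ℝ => z j * G z) s z := by
    have h := iteratedFDerivWithin_add_apply (i := q) ((hA z hz).of_le (by exact_mod_cast hq))
      ((hB z hz).of_le (by exact_mod_cast hq)) hsu hz
    exact h
  rw [hadd]
  calc ‖iteratedFDerivWithin ℝ q (fun z : Fin n → ℝ => (1 - z j) * F z) s z +
        iteratedFDerivWithin ℝ q (fun z : Fin n → ℝ => z j * G z) s z‖
      ≤ 2 ^ q * C + 2 ^ q * C := by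
        refine (norm_add_le _ _).trans (add_le_add ?_ ?_)
        · rw [iteratedFDerivWithin_of_isOpen q hopen hz]; exact hbA q hq z hz
        · rw [iteratedFDerivWithin_of_isOpen q hopen hz]; exact hbB q hq z hz
    _ = 2 ^ (q + 1) * C := by ring


/-! ### Composition of cube maps (Pila–Wilkie 2006, §5: `φ ∘ ψ`) -/

/-- **Vector-valued bounds from coordinate bounds**: for `Φ : E → ℝ^k` (sup norm) the norm of
the `i`-th derivative within `s` is at most `D` as soon as each coordinate's is. [folklore] -/
theorem norm_iteratedFDerivWithin_pi_le {E : Type} [NormedAddCommGroup E] [NormedSpace ℝ E]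
    {k : ℕ} {Φ : E → (Fin k → ℝ)} {s : Set E} {x : E} {N : WithTop ℕ∞} {i : ℕ} {D : ℝ}
    (hΦ : ∀ c, ContDiffOn ℝ N (fun x => Φ x c) s) (hs : UniqueDiffOn ℝ s) (hx : x ∈ s)
    (hi : (i : WithTop ℕ∞) ≤ N) (hD0 : 0 ≤ D)
    (hD : ∀ c, ‖iteratedFDerivWithin ℝ i (fun x => Φ x c) s x‖ ≤ D) :
    ‖iteratedFDerivWithin ℝ i Φ s x‖ ≤ D := by
  have hΦ' : ContDiffOn ℝ N Φ s := contDiffOn_pi' hΦ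
  refine ContinuousMultilinearMap.opNorm_le_bound (by positivity) fun m => ?_
  rw [pi_norm_le_iff_of_nonneg (by positivity)]
  intro c
  have hcomp : (fun x => Φ x c) = (ContinuousLinearMap.proj (R := ℝ) c : (Fin k → ℝ) →L[ℝ] ℝ) ∘ Φ := rfl
  have h := (ContinuousLinearMap.proj (R := ℝ) c : (Fin k → ℝ) →L[ℝ] ℝ).iteratedFDerivWithin_comp_left
    (hΦ' x hx) hs hx hi
  have heval : iteratedFDerivWithin ℝ i Φ s x m c = iteratedFDerivWithin ℝ i (fun x => Φ x c) s x m := by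
    rw [hcomp, h]; rfl
  rw [heval]
  exact (ContinuousMultilinearMap.le_opNorm _ m).trans (mul_le_mul_of_nonneg_right (hD c)
    (Finset.prod_nonneg fun _ _ => norm_nonneg _))

/-- **Composition of cube maps** (Pila–Wilkie 2006, §5, the maps `φ ∘ ψ`): if
`φ : (0,1)^{ℓ'} → ℝ` is `C^r` with `‖D^i φ‖ ≤ C` and `ψ : (0,1)^ℓ → (0,1)^{ℓ'}` has `C^r`
coordinates with `‖D^i ψ_c‖ ≤ D^i` for `1 ≤ i ≤ r` (`D ≥ 0`), then `φ ∘ ψ` is `C^r` on `(0,1)^ℓ`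
with `‖D^q (φ ∘ ψ)‖ ≤ q! C D^q` (Mathlib's Faà di Bruno bound
`norm_iteratedFDerivWithin_comp_le`). [cite: PilaWilkie2006, §5] -/
theorem contDiffOn_norm_iteratedFDeriv_comp_cube {ℓ ℓ' r : ℕ} {φ : (Fin ℓ' → ℝ) → ℝ}
    {ψ : (Fin ℓ → ℝ) → (Fin ℓ' → ℝ)} {C D : ℝ} (hD0 : 0 ≤ D)
    (hφ : ContDiffOn ℝ r φ (Set.pi Set.univ fun _ : Fin ℓ' => Ioo (0 : ℝ) 1))
    (hbφ : ∀ q ≤ r, ∀ y ∈ Set.pi Set.univ (fun _ : Fin ℓ' => Ioo (0 : ℝ) 1), ‖iteratedFDeriv ℝ q φ y‖ ≤ C)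
    (hψ : ∀ c, ContDiffOn ℝ r (fun x => ψ x c) (Set.pi Set.univ fun _ : Fin ℓ => Ioo (0 : ℝ) 1))
    (hmaps : MapsTo ψ (Set.pi Set.univ fun _ : Fin ℓ => Ioo (0 : ℝ) 1)
      (Set.pi Set.univ fun _ : Fin ℓ' => Ioo (0 : ℝ) 1))
    (hbψ : ∀ c, ∀ q, 1 ≤ q → q ≤ r → ∀ x ∈ Set.pi Set.univ (fun _ : Fin ℓ => Ioo (0 : ℝ) 1),
      ‖iteratedFDeriv ℝ q (fun x => ψ x c) x‖ ≤ D ^ q) :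
    ContDiffOn ℝ r (fun x => φ (ψ x)) (Set.pi Set.univ fun _ : Fin ℓ => Ioo (0 : ℝ) 1) ∧
      ∀ q ≤ r, ∀ x ∈ Set.pi Set.univ (fun _ : Fin ℓ => Ioo (0 : ℝ) 1),
        ‖iteratedFDeriv ℝ q (fun x => φ (ψ x)) x‖ ≤ q.factorial * C * D ^ q := by
  set s : Set (Fin ℓ → ℝ) := Set.pi Set.univ fun _ : Fin ℓ => Ioo (0 : ℝ) 1 with hs
  set t : Set (Fin ℓ' → ℝ) := Set.pi Set.univ fun _ : Fin ℓ' => Ioo (0 : ℝ) 1 with ht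
  have hso : IsOpen s := isOpen_set_pi finite_univ fun _ _ => isOpen_Ioo
  have hto : IsOpen t := isOpen_set_pi finite_univ fun _ _ => isOpen_Ioo
  have hψ' : ContDiffOn ℝ r ψ s := contDiffOn_pi' hψ
  refine ⟨hφ.comp hψ' hmaps, fun q hq x hx => ?_⟩
  rw [← iteratedFDerivWithin_of_isOpen q hso hx]
  have h := norm_iteratedFDerivWithin_comp_le (n := q) (N := (r : WithTop ℕ∞)) hφ hψ' (by exact_mod_cast hq)
    hto.uniqueDiffOn hso.uniqueDiffOn hmaps hx (C := C) (D := D) ?_ ?_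
  · exact h
  · intro i hi
    rw [iteratedFDerivWithin_of_isOpen i hto (hmaps hx)]
    exact hbφ i (hi.trans hq) _ (hmaps hx)
  · intro i hi1 hi
    refine norm_iteratedFDerivWithin_pi_le (N := (r : WithTop ℕ∞)) hψ hso.uniqueDiffOn hx
      (by exact_mod_cast hi.trans hq) (by positivity) fun c => ?_
    rw [iteratedFDerivWithin_of_isOpen i hso hx]
    exact hbψ c i hi1 (hi.trans hq) x hx


/-! ### Renormalization by subdivision (Pila–Wilkie 2006, Cor. 5.1: *"Cover `(0,1)^{dim X}` with `(2c)^{dim X}` cubes of side `1/c`"*) -/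

/-- **Scaling of derivatives under affine reparametrization**: for `g` of class `C^r` on the
open cube with `‖D^q g‖ ≤ C` and the affine map `A(x) = v + κ x` mapping the cube into itself,
`‖D^q (g ∘ A)‖ ≤ C |κ|^q` on the cube. [folklore] -/
theorem norm_iteratedFDeriv_comp_affine_le {ℓ r : ℕ} {g : (Fin ℓ → ℝ) → ℝ} {C : ℝ} (v : Fin ℓ → ℝ) (κ : ℝ)
    (hg : ContDiffOn ℝ r g (Set.pi Set.univ fun _ : Fin ℓ => Ioo (0 : ℝ) 1))
    (hb : ∀ q ≤ r, ∀ y ∈ Set.pi Set.univ (fun _ : Fin ℓ => Ioo (0 : ℝ) 1), ‖iteratedFDeriv ℝ q g y‖ ≤ C)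
    (hmaps : MapsTo (fun x : Fin ℓ → ℝ => v + κ • x) (Set.pi Set.univ fun _ : Fin ℓ => Ioo (0 : ℝ) 1)
      (Set.pi Set.univ fun _ : Fin ℓ => Ioo (0 : ℝ) 1)) :
    ContDiffOn ℝ r (fun x => g (v + κ • x)) (Set.pi Set.univ fun _ : Fin ℓ => Ioo (0 : ℝ) 1) ∧
      ∀ q ≤ r, ∀ x ∈ Set.pi Set.univ (fun _ : Fin ℓ => Ioo (0 : ℝ) 1),
        ‖iteratedFDeriv ℝ q (fun x => g (v + κ • x)) x‖ ≤ C * |κ| ^ q := by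
  set t : Set (Fin ℓ → ℝ) := Set.pi Set.univ fun _ : Fin ℓ => Ioo (0 : ℝ) 1 with ht
  have hto : IsOpen t := isOpen_set_pi finite_univ fun _ _ => isOpen_Ioo
  set L : (Fin ℓ → ℝ) →L[ℝ] (Fin ℓ → ℝ) := κ • ContinuousLinearMap.id ℝ (Fin ℓ → ℝ) with hL
  have hLapply : ∀ x, L x = κ • x := fun x => rfl
  have haff : ContDiff ℝ r (fun x : Fin ℓ → ℝ => v + κ • x) := contDiff_const.add (contDiff_id.const_smul κ)
  refine ⟨hg.comp haff.contDiffOn hmaps, fun q hq x hx => ?_⟩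
  -- translate: `g₁ y = g (v + y)` on `t₁ = {y | v + y ∈ t}`
  set g₁ : (Fin ℓ → ℝ) → ℝ := fun y => g (v + y) with hg₁
  set t₁ : Set (Fin ℓ → ℝ) := (fun y => v + y) ⁻¹' t with ht₁
  have ht₁o : IsOpen t₁ := hto.preimage (continuous_const.add continuous_id)
  have hg₁c : ContDiffOn ℝ r g₁ t₁ := hg.comp (contDiff_const.add contDiff_id).contDiffOn fun y hy => hy
  have hLx : L x ∈ t₁ := by show v + κ • x ∈ t; exact hmaps hx
  have hpre : IsOpen (L ⁻¹' t₁) := ht₁o.preimage L.continuous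
  have hcomp : (fun x => g (v + κ • x)) = g₁ ∘ L := rfl
  rw [← iteratedFDerivWithin_of_isOpen q hpre hLx, hcomp,
    L.iteratedFDerivWithin_comp_right hg₁c ht₁o.uniqueDiffOn hpre.uniqueDiffOn hLx (i := q) (by exact_mod_cast hq)]
  have hLn : ‖L‖ ≤ |κ| := by
    rw [hL]
    refine (norm_smul_le κ (ContinuousLinearMap.id ℝ (Fin ℓ → ℝ))).trans ?_
    rw [Real.norm_eq_abs]
    exact mul_le_of_le_one_right (abs_nonneg κ) ContinuousLinearMap.norm_id_le
  have hC : 0 ≤ C := (norm_nonneg _).trans (hb 0 (Nat.zero_le _) _ (hmaps hx))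
  have hinner : ‖iteratedFDerivWithin ℝ q g₁ t₁ (L x)‖ ≤ C := by
    rw [iteratedFDerivWithin_of_isOpen q ht₁o hLx, hg₁, iteratedFDeriv_comp_add_left q v (L x)]
    exact hb q hq (v + L x) (hmaps hx)
  calc ‖(iteratedFDerivWithin ℝ q g₁ t₁ (L x)).compContinuousLinearMap fun _ => L‖
      ≤ ‖iteratedFDerivWithin ℝ q g₁ t₁ (L x)‖ * ∏ _i : Fin q, ‖L‖ :=
        ContinuousMultilinearMap.norm_compContinuousLinearMap_le _ _
    _ ≤ C * |κ| ^ q := by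
        rw [Finset.prod_const, Finset.card_univ, Fintype.card_fin]
        exact mul_le_mul hinner (pow_le_pow_left₀ (norm_nonneg _) hLn q)
          (pow_nonneg (norm_nonneg _) q) hC

/-- **The subdivision grid** (Pila–Wilkie 2006, Cor. 5.1): for `K ≥ 1` the affine maps
`A_a(x)_i = a_i/(2K) + x_i/K`, `a ∈ {0, …, 2K−2}^ℓ`, map the open cube `(0,1)^ℓ` into itself
and their images cover it. [cite: PilaWilkie2006, Cor. 5.1] -/
theorem subdivision_grid {ℓ K : ℕ} (hK : 1 ≤ K) :
    (∀ a : Fin ℓ → Fin (2 * K - 1),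
      MapsTo (fun x : Fin ℓ → ℝ => (fun i => ((a i : ℕ) : ℝ) / (2 * K)) + (1 / K : ℝ) • x)
        (Set.pi Set.univ fun _ : Fin ℓ => Ioo (0 : ℝ) 1) (Set.pi Set.univ fun _ : Fin ℓ => Ioo (0 : ℝ) 1)) ∧
    ∀ y ∈ Set.pi Set.univ (fun _ : Fin ℓ => Ioo (0 : ℝ) 1), ∃ a : Fin ℓ → Fin (2 * K - 1),
      ∃ x ∈ Set.pi Set.univ (fun _ : Fin ℓ => Ioo (0 : ℝ) 1),
        (fun i => ((a i : ℕ) : ℝ) / (2 * K)) + (1 / K : ℝ) • x = y := by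
  have hK0 : (0 : ℝ) < K := by exact_mod_cast hK
  have h2K : (0 : ℝ) < 2 * K := by positivity
  constructor
  · intro a x hx i _
    simp only [Pi.add_apply, Pi.smul_apply, smul_eq_mul]
    have hxi := hx i (mem_univ _)
    have hai : ((a i : ℕ) : ℝ) + 2 ≤ 2 * K := by
      have h := (a i).isLt
      have : (a i : ℕ) + 2 ≤ 2 * K := by omega
      exact_mod_cast this
    constructor
    · have : (0 : ℝ) ≤ ((a i : ℕ) : ℝ) / (2 * K) := by positivity
      have : (0 : ℝ) < 1 / K * x i := by have := hxi.1; positivity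
      linarith
    · rw [show ((a i : ℕ) : ℝ) / (2 * K) + 1 / K * x i = (((a i : ℕ) : ℝ) + 2 * x i) / (2 * K) by
        field_simp]
      rw [div_lt_one h2K]
      linarith [hxi.2]
  · intro y hy
    -- coordinatewise: `t_i = min (⌈2K y_i⌉ - 1) (2K - 2)`
    have hcoord : ∀ i, ∃ t : ℕ, t < 2 * K - 1 ∧ (t : ℝ) / (2 * K) < y i ∧ y i < (t : ℝ) / (2 * K) + 1 / K := by
      intro i
      have hyi := hy i (mem_univ _)
      set c : ℕ := ⌈2 * K * y i⌉₊ with hc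
      have hc1 : 1 ≤ c := Nat.one_le_iff_ne_zero.mpr (Nat.pos_iff_ne_zero.mp (Nat.ceil_pos.mpr (by have := hyi.1; positivity)))
      have hcle : (c : ℝ) - 1 < 2 * K * y i := by
        have := Nat.ceil_lt_add_one (show (0 : ℝ) ≤ 2 * K * y i by have := hyi.1; positivity)
        rw [hc]; linarith
      have hcge : 2 * K * y i ≤ c := Nat.le_ceil _
      have hc2K : c ≤ 2 * K := by
        have : (c : ℝ) < 2 * K + 1 := by
          have : 2 * K * y i < 2 * K := by nlinarith [hyi.2]
          linarith
        have : c < 2 * K + 1 := by exact_mod_cast this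
        omega
      refine ⟨min (c - 1) (2 * K - 2), ?_, ?_, ?_⟩
      · omega
      · have hm : ((min (c - 1) (2 * K - 2) : ℕ) : ℝ) ≤ (c : ℝ) - 1 := by
          have : min (c - 1) (2 * K - 2) ≤ c - 1 := min_le_left _ _
          have h' : ((min (c - 1) (2 * K - 2) : ℕ) : ℝ) ≤ ((c - 1 : ℕ) : ℝ) := by exact_mod_cast this
          rwa [Nat.cast_sub hc1, Nat.cast_one] at h'
        rw [div_lt_iff₀ h2K]
        linarith
      · rcases le_or_gt (c - 1) (2 * K - 2) with h | h
        · rw [min_eq_left h]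
          rw [Nat.cast_sub hc1, Nat.cast_one]
          have : y i < ((c : ℝ) - 1) / (2 * K) + 1 / K := by
            rw [show ((c : ℝ) - 1) / (2 * K) + 1 / K = ((c : ℝ) + 1) / (2 * K) by field_simp; ring,
              lt_div_iff₀ h2K]
            linarith
          exact this
        · rw [min_eq_right h.le]
          have hK2 : ((2 * K - 2 : ℕ) : ℝ) = 2 * K - 2 := by
            rw [Nat.cast_sub (by omega), Nat.cast_mul]; norm_num
          rw [hK2, show ((2 : ℝ) * K - 2) / (2 * K) + 1 / K = 1 by field_simp; ring]
          exact hyi.2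
    choose t ht using hcoord
    refine ⟨fun i => ⟨t i, (ht i).1⟩, fun i => K * (y i - (t i : ℝ) / (2 * K)), fun i _ => ?_, ?_⟩
    · obtain ⟨-, h1, h2⟩ := ht i
      constructor
      · show 0 < (K : ℝ) * (y i - (t i : ℝ) / (2 * K)); nlinarith
      · show (K : ℝ) * (y i - (t i : ℝ) / (2 * K)) < 1
        have : y i - (t i : ℝ) / (2 * K) < 1 / K := by linarith
        calc (K : ℝ) * (y i - (t i : ℝ) / (2 * K)) < K * (1 / K) := by
              exact mul_lt_mul_of_pos_left this hK0
          _ = 1 := by field_simp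
    · funext i
      simp only [Pi.add_apply, Pi.smul_apply, smul_eq_mul]
      field_simp
      ring

end BandMaps


end Literature.ModelTheory.ExponentialFields

end
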